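import Mathlib.Analysis.SpecialFunctions.Trigonometric.Basic
import Mathlib.Data.Matrix.Mul
import Mathlib.LinearAlgebra.Matrix.Notation
import Mathlib.Tactic.FinCases

/-!
# Exact two-leg ladder band identities (bonding/antibonding ↔ two chains)

The EXACT bookkeeping behind fitting the two low-energy LDA bands of a two-leg cuprate ladder
(SrCu₂O₃, Sr₁₄₋ₓCaₓCu₂₄O₄₁) either as a bonding/antibonding pair with "rung-scheme" parameters per
band, or as ONE intersite model with leg, rung and diagonal hoppings [MullerEtAl1998, Eqs. (2)–(3),
Tables I–II].  Everything is a proved theorem; there are no named facts.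

For an isolated ladder (one orbital per Cu, the two legs as the `Fin 2` index) the Bloch matrix at
leg momentum `k` is the symmetric `2 × 2` matrix `!![a, c; c, a]` with the intra-leg dispersion
`a(k) = ε₀ − 2t cos k − 2t₂ cos 2k` (`ladderLegDispersion`; nearest `t = t_{∥,1}` and second
`t₂ = t_{∥,2}` leg hoppings) and the inter-leg element
`c(k) = t⊥ + 2t′ cos k + 2t₂′ cos 2k` (`ladderInterLeg`; rung `t⊥ = t_{⊥,1}`, plaquette diagonal
`t′ = t_{⊥,4}`, second diagonal `t₂′ = t_{⊥,6}`), exactly the `ε_∥(k_z)` and `ε_{⊥,3}(k_z)` of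
[MullerEtAl1998, Eq. (3)] with the inter-ladder terms dropped.  Proved here:
* `ladderBloch_mulVec_even/odd`: `(1, 1)` and `(1, −1)` are eigenvectors with eigenvalues
  `a + c` and `a − c` for every `k` (the two "rung bands");
* `ladder_band_minus/plus`: each of `a ∓ c` is again a CHAIN dispersion
  `(ε₀ ∓ t⊥) − 2(t ± t′) cos k − 2(t₂ ± t₂′) cos 2k` — i.e. fitting the two bands separately as chains
  (the rung scheme `ε₀^{b/a}, h_{∥,1}^{b/a}, h_{∥,2}^{b/a}` of [MullerEtAl1998, Eq. (2), Table I])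
  returns `h_{∥,1}^{b/a} = t ± t′`, `h_{∥,2}^{b/a} = t₂ ± t₂′`, `ε₀^{b/a} = ε₀ ∓ t⊥`: the diagonal
  hopping is absorbed into DIFFERENT leg hoppings of the two bands and the rung hopping into their
  offsets — their Table I (Sr₁₄Cu₂₄O₄₁: `h_{∥,1}` = 0.41 / 0.59 eV, `ε₀` = −0.31 / 0.46 eV) and
  Table II (`t_{∥,1}` = 0.500, `t_{⊥,4}` = −0.090, `t_{⊥,1}` = 0.385, `ε₀` = 0.075 eV) are related by
  exactly these identities;
* `ladder_rungScheme_inversion`: conversely `t = (h_b + h_a)/2`, `t′ = (h_b − h_a)/2`,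
  `t⊥ = (ε_a − ε_b)/2`, `ε₀ = (ε_a + ε_b)/2`.
The ladder analogue of the bilayer statements in `BilayerSplittingIdentities` (`charpoly_bilayer`,
`squareDispersion₃_add_chakravartyForm`).  Which of `a ± c` is the LOWER (bonding) band depends on
the sign of `c(k)`, i.e. on orbital phase conventions — not asserted here.

Not here: inter-ladder (trellis) couplings `t_{⊥,2}, t_{⊥,3}, t_{⊥,5}, t_{⊥,7}` and the `k_x`
dependence of [MullerEtAl1998, Eq. (3)], interactions, anything approximate.

Reference: T. F. A. Müller, V. Anisimov, T. M. Rice, I. Dasgupta, T. Saha-Dasgupta, *Electronic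
structure of ladder cuprates*, Phys. Rev. B 57 (1998) R12655, arXiv:cond-mat/9801280, Eqs. (2)–(3),
Tables I–II.  AI-produced formalisation (H21, cell hubbard-downfold, seat lit-2, 2026-08-27); no
facts, no axioms beyond Mathlib's, no `sorry`.
-/

namespace Literature.MathematicalPhysics.QuantumLattice

open Real Matrix

/-- Intra-leg dispersion of a two-leg ladder at leg momentum `k`: on-site `ε₀`, nearest-neighbour
leg hopping `t`, second-neighbour leg hopping `t₂` (`ε_∥` of [MullerEtAl1998, Eq. (3)] plus `ε₀`).
[cite: MullerEtAl1998, Eq. (3)] -/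
noncomputable def ladderLegDispersion (ε₀ t t₂ k : ℝ) : ℝ :=
  ε₀ - 2 * t * cos k - 2 * t₂ * cos (2 * k)

/-- Inter-leg Bloch element of an isolated two-leg ladder: rung `t⊥`, plaquette-diagonal `t′`
(two diagonals ⇒ `2t′ cos k`), second diagonal `t₂′` (`ε_{⊥,3}` of [MullerEtAl1998, Eq. (3)]).
[cite: MullerEtAl1998, Eq. (3)] -/
noncomputable def ladderInterLeg (tperp t' t₂' k : ℝ) : ℝ :=
  tperp + 2 * t' * cos k + 2 * t₂' * cos (2 * k)

/-- Unfolding. [cite: MullerEtAl1998, Eq. (3)] -/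
theorem ladderLegDispersion_def (ε₀ t t₂ k : ℝ) :
    ladderLegDispersion ε₀ t t₂ k = ε₀ - 2 * t * cos k - 2 * t₂ * cos (2 * k) := rfl

/-- Unfolding. [cite: MullerEtAl1998, Eq. (3)] -/
theorem ladderInterLeg_def (tperp t' t₂' k : ℝ) :
    ladderInterLeg tperp t' t₂' k = tperp + 2 * t' * cos k + 2 * t₂' * cos (2 * k) := rfl

/-- The `2 × 2` Bloch matrix of the isolated two-leg ladder (legs = `Fin 2`) with intra-leg entry
`a` and inter-leg entry `c`: `!![a, c; c, a]`. [cite: MullerEtAl1998, Eq. (3)] -/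
def ladderBloch (a c : ℝ) : Matrix (Fin 2) (Fin 2) ℝ :=
  !![a, c; c, a]

/-- Unfolding. [cite: MullerEtAl1998, Eq. (3)] -/
theorem ladderBloch_def (a c : ℝ) : ladderBloch a c = !![a, c; c, a] := rfl

/-- The EVEN leg combination `(1, 1)` is an eigenvector with eigenvalue `a + c`, for all entries.
[cite: MullerEtAl1998, Eq. (3)] -/
theorem ladderBloch_mulVec_even (a c : ℝ) :
    ladderBloch a c *ᵥ ![1, 1] = (a + c) • ![1, 1] := by
  ext i
  fin_cases i
  · simp [ladderBloch, Matrix.mulVec, dotProduct, Fin.sum_univ_two]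
  · simp [ladderBloch, Matrix.mulVec, dotProduct, Fin.sum_univ_two]
    ring

/-- The ODD leg combination `(1, −1)` is an eigenvector with eigenvalue `a − c`, for all entries.
[cite: MullerEtAl1998, Eq. (3)] -/
theorem ladderBloch_mulVec_odd (a c : ℝ) :
    ladderBloch a c *ᵥ ![1, -1] = (a - c) • ![1, -1] := by
  ext i
  fin_cases i <;> simp [ladderBloch, Matrix.mulVec, dotProduct, Fin.sum_univ_two] <;> ring

/-- **Each ladder band is a chain** [cite: MullerEtAl1998, Eqs. (2)–(3) and Tables I–II]: the
`a − c` band of the isolated ladder equals the chain dispersion with on-site `ε₀ − t⊥`, leg hopping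
`t + t′` and second-neighbour hopping `t₂ + t₂′` (rung-scheme parameters of one band). -/
theorem ladder_band_minus (ε₀ t t₂ tperp t' t₂' k : ℝ) :
    ladderLegDispersion ε₀ t t₂ k - ladderInterLeg tperp t' t₂' k
      = ladderLegDispersion (ε₀ - tperp) (t + t') (t₂ + t₂') k := by
  simp only [ladderLegDispersion, ladderInterLeg]
  ring

/-- **Each ladder band is a chain** [cite: MullerEtAl1998, Eqs. (2)–(3) and Tables I–II]: the
`a + c` band equals the chain dispersion with on-site `ε₀ + t⊥`, leg hopping `t − t′` and
second-neighbour hopping `t₂ − t₂′` (rung-scheme parameters of the other band). -/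
theorem ladder_band_plus (ε₀ t t₂ tperp t' t₂' k : ℝ) :
    ladderLegDispersion ε₀ t t₂ k + ladderInterLeg tperp t' t₂' k
      = ladderLegDispersion (ε₀ + tperp) (t - t') (t₂ - t₂') k := by
  simp only [ladderLegDispersion, ladderInterLeg]
  ring

/-- The two ladder bands as eigenpairs of the Bloch matrix built from the leg dispersion and the
inter-leg element, written directly in chain form (combines `ladderBloch_mulVec_odd/even` with
`ladder_band_minus/plus`). [cite: MullerEtAl1998, Eqs. (2)–(3)] -/
theorem ladderBloch_bands (ε₀ t t₂ tperp t' t₂' k : ℝ) :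
    ladderBloch (ladderLegDispersion ε₀ t t₂ k) (ladderInterLeg tperp t' t₂' k) *ᵥ ![1, -1]
        = ladderLegDispersion (ε₀ - tperp) (t + t') (t₂ + t₂') k • ![1, -1] ∧
      ladderBloch (ladderLegDispersion ε₀ t t₂ k) (ladderInterLeg tperp t' t₂' k) *ᵥ ![1, 1]
        = ladderLegDispersion (ε₀ + tperp) (t - t') (t₂ - t₂') k • ![1, 1] := by
  constructor
  · rw [ladderBloch_mulVec_odd, ladder_band_minus]
  · rw [ladderBloch_mulVec_even, ladder_band_plus]

/-- **Rung-scheme ↔ intersite inversion** [cite: MullerEtAl1998, Tables I–II]: if the two bands,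
fitted separately as chains, have on-site energies `ε_b = ε₀ − t⊥`, `ε_a = ε₀ + t⊥` and leg hoppings
`h_b = t + t′`, `h_a = t − t′` (second neighbours `g_b = t₂ + t₂′`, `g_a = t₂ − t₂′`), then the
intersite parameters are recovered as half-sums and half-differences:
`ε₀ = (ε_a + ε_b)/2`, `t⊥ = (ε_a − ε_b)/2`, `t = (h_b + h_a)/2`, `t′ = (h_b − h_a)/2`,
`t₂ = (g_b + g_a)/2`, `t₂′ = (g_b − g_a)/2` (e.g. Sr₁₄Cu₂₄O₄₁: `h_b, h_a` = 0.41, 0.59 eV ⇒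
`t` = 0.50, `t′` = −0.09; `ε_b, ε_a` = −0.31, 0.46 ⇒ `ε₀` = 0.075, `t⊥` = 0.385 eV, their Table II). -/
theorem ladder_rungScheme_inversion (ε₀ t t₂ tperp t' t₂' ε_b ε_a h_b h_a g_b g_a : ℝ)
    (hεb : ε_b = ε₀ - tperp) (hεa : ε_a = ε₀ + tperp) (hhb : h_b = t + t') (hha : h_a = t - t')
    (hgb : g_b = t₂ + t₂') (hga : g_a = t₂ - t₂') :
    ε₀ = (ε_a + ε_b) / 2 ∧ tperp = (ε_a - ε_b) / 2 ∧ t = (h_b + h_a) / 2 ∧ t' = (h_b - h_a) / 2 ∧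
      t₂ = (g_b + g_a) / 2 ∧ t₂' = (g_b - g_a) / 2 := by
  subst hεb hεa hhb hha hgb hga
  refine ⟨?_, ?_, ?_, ?_, ?_, ?_⟩ <;> ring

/-- At the leg-zone boundary `k = π/2` (`cos k = 0`) the two bands differ by exactly
`2(t⊥ − 2t₂′)`: the band splitting there carries no information on `t` or `t′`.
[cite: MullerEtAl1998, Eq. (3)] -/
theorem ladder_splitting_half_pi (ε₀ t t₂ tperp t' t₂' : ℝ) :
    (ladderLegDispersion ε₀ t t₂ (π / 2) + ladderInterLeg tperp t' t₂' (π / 2))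
        - (ladderLegDispersion ε₀ t t₂ (π / 2) - ladderInterLeg tperp t' t₂' (π / 2))
      = 2 * (tperp - 2 * t₂') := by
  have h1 : cos (π / 2) = 0 := Real.cos_pi_div_two
  have h2 : cos (2 * (π / 2)) = -1 := by rw [mul_div_cancel₀ π two_ne_zero, Real.cos_pi]
  simp only [ladderLegDispersion, ladderInterLeg, h1, h2]
  ring

/-- At the zone centre `k = 0` the splitting of the two bands is `2(t⊥ + 2t′ + 2t₂′)`.
[cite: MullerEtAl1998, Eq. (3)] -/
theorem ladder_splitting_zero (ε₀ t t₂ tperp t' t₂' : ℝ) :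
    (ladderLegDispersion ε₀ t t₂ 0 + ladderInterLeg tperp t' t₂' 0)
        - (ladderLegDispersion ε₀ t t₂ 0 - ladderInterLeg tperp t' t₂' 0)
      = 2 * (tperp + 2 * t' + 2 * t₂') := by
  simp only [ladderLegDispersion, ladderInterLeg, mul_zero, Real.cos_zero]
  ring

end Literature.MathematicalPhysics.QuantumLattice
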